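import Summits.Ventures.PercRepro2.CaseOneStarBlockQtIZero
import Summits.Ventures.PercRepro2.CaseOneStarEpsQtIA
import Summits.Ventures.PercRepro2.CaseOneStarEpsQtIB

/-!
# The marked star, Q-threshold form: `iQt4 ≥ 0`
(blind cell PercRepro2, p1 g16; S5 §2.1 (K9) (q))

`iQt4 = (1 − q₂) · EredQtI` (`iQt4_factor`), `EredQtI` by its `(q₁, q₂)`-Bernstein form (`EredQtI_bern`) from the
twelve `epsQtI_ij` — nine nonnegative on `[0, 1]²` (`epsQtI_ij_nonneg`, CaseOneStarEpsQtIA/B.lean), three identically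
zero (`CaseOneStarBlockQtIZero.lean`) — so **`iQt4_nonneg`**. -/

namespace Summit.Ventures.PercRepro2

namespace CaseOne

section MainQtI
variable {R : Type*} [Field R] [LinearOrder R] [IsStrictOrderedRing R]

/-- **`iQt4 ≥ 0`** for weights in `[0, 1]` and cells satisfying the facts. -/
theorem iQt4_nonneg (q₁ q₂ r s : R) (m : SCells R) (hf : SFacts m)
    (hq₁ : 0 ≤ q₁) (hq₁' : q₁ ≤ 1) (hq₂ : 0 ≤ q₂) (hq₂' : q₂ ≤ 1) (hr : 0 ≤ r) (hr' : r ≤ 1)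
    (hs : 0 ≤ s) (hs' : s ≤ 1) : 0 ≤ iQt4 q₁ q₂ r s m := by
  have hq₁1 : 0 ≤ 1 - q₁ := sub_nonneg.2 hq₁'
  have hq₂1 : 0 ≤ 1 - q₂ := sub_nonneg.2 hq₂'
  have hepsQtI00 : 0 ≤ epsQtI00 r s m := epsQtI00_nonneg r s m hf hr hr' hs hs'
  have hepsQtI01 : 0 ≤ epsQtI01 r s m := epsQtI01_nonneg r s m hf hr hr' hs hs'
  have hepsQtI02 : 0 ≤ epsQtI02 r s m := epsQtI02_nonneg r s m hf hr hr' hs hs'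
  have hepsQtI10 : 0 ≤ epsQtI10 r s m := epsQtI10_nonneg r s m hf hr hr' hs hs'
  have hepsQtI11 : 0 ≤ epsQtI11 r s m := epsQtI11_nonneg r s m hf hr hr' hs hs'
  have hepsQtI12 : 0 ≤ epsQtI12 r s m := epsQtI12_nonneg r s m hf hr hr' hs hs'
  have hepsQtI20 : 0 ≤ epsQtI20 r s m := epsQtI20_nonneg r s m hf hr hr' hs hs'
  have hepsQtI21 : 0 ≤ epsQtI21 r s m := epsQtI21_nonneg r s m hf hr hr' hs hs'
  have hepsQtI22 : 0 ≤ epsQtI22 r s m := by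
    rw [epsQtI22_eq_zero]
  have hepsQtI30 : 0 ≤ epsQtI30 r s m := epsQtI30_nonneg r s m hf hr hr' hs hs'
  have hepsQtI31 : 0 ≤ epsQtI31 r s m := by
    rw [epsQtI31_eq_zero]
  have hepsQtI32 : 0 ≤ epsQtI32 r s m := by
    rw [epsQtI32_eq_zero]
  have hE : 0 ≤ EredQtI q₁ q₂ r s m := by
    have key := EredQtI_bern q₁ q₂ r s m
    have w2 : ∀ (c : R) (i j : ℕ), 0 ≤ c →
        0 ≤ c * q₁ ^ i * (1 - q₁) ^ (3 - i) * q₂ ^ j * (1 - q₂) ^ (2 - j) := fun c i j hc =>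
      mul_nonneg (mul_nonneg (mul_nonneg (mul_nonneg hc (pow_nonneg hq₁ _)) (pow_nonneg hq₁1 _))
        (pow_nonneg hq₂ _)) (pow_nonneg hq₂1 _)
    have e00 : 0 ≤ (1 : R) * q₁ ^ 0 * (1 - q₁) ^ 3 * q₂ ^ 0 * (1 - q₂) ^ 2 * epsQtI00 r s m :=
      mul_nonneg (w2 1 0 0 (by norm_num)) hepsQtI00
    have e01 : 0 ≤ (2 : R) * q₁ ^ 0 * (1 - q₁) ^ 3 * q₂ ^ 1 * (1 - q₂) ^ 1 * epsQtI01 r s m :=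
      mul_nonneg (w2 2 0 1 (by norm_num)) hepsQtI01
    have e02 : 0 ≤ (1 : R) * q₁ ^ 0 * (1 - q₁) ^ 3 * q₂ ^ 2 * (1 - q₂) ^ 0 * epsQtI02 r s m :=
      mul_nonneg (w2 1 0 2 (by norm_num)) hepsQtI02
    have e10 : 0 ≤ (3 : R) * q₁ ^ 1 * (1 - q₁) ^ 2 * q₂ ^ 0 * (1 - q₂) ^ 2 * epsQtI10 r s m :=
      mul_nonneg (w2 3 1 0 (by norm_num)) hepsQtI10
    have e11 : 0 ≤ (6 : R) * q₁ ^ 1 * (1 - q₁) ^ 2 * q₂ ^ 1 * (1 - q₂) ^ 1 * epsQtI11 r s m :=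
      mul_nonneg (w2 6 1 1 (by norm_num)) hepsQtI11
    have e12 : 0 ≤ (3 : R) * q₁ ^ 1 * (1 - q₁) ^ 2 * q₂ ^ 2 * (1 - q₂) ^ 0 * epsQtI12 r s m :=
      mul_nonneg (w2 3 1 2 (by norm_num)) hepsQtI12
    have e20 : 0 ≤ (3 : R) * q₁ ^ 2 * (1 - q₁) ^ 1 * q₂ ^ 0 * (1 - q₂) ^ 2 * epsQtI20 r s m :=
      mul_nonneg (w2 3 2 0 (by norm_num)) hepsQtI20
    have e21 : 0 ≤ (6 : R) * q₁ ^ 2 * (1 - q₁) ^ 1 * q₂ ^ 1 * (1 - q₂) ^ 1 * epsQtI21 r s m :=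
      mul_nonneg (w2 6 2 1 (by norm_num)) hepsQtI21
    have e22 : 0 ≤ (3 : R) * q₁ ^ 2 * (1 - q₁) ^ 1 * q₂ ^ 2 * (1 - q₂) ^ 0 * epsQtI22 r s m :=
      mul_nonneg (w2 3 2 2 (by norm_num)) hepsQtI22
    have e30 : 0 ≤ (1 : R) * q₁ ^ 3 * (1 - q₁) ^ 0 * q₂ ^ 0 * (1 - q₂) ^ 2 * epsQtI30 r s m :=
      mul_nonneg (w2 1 3 0 (by norm_num)) hepsQtI30
    have e31 : 0 ≤ (2 : R) * q₁ ^ 3 * (1 - q₁) ^ 0 * q₂ ^ 1 * (1 - q₂) ^ 1 * epsQtI31 r s m :=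
      mul_nonneg (w2 2 3 1 (by norm_num)) hepsQtI31
    have e32 : 0 ≤ (1 : R) * q₁ ^ 3 * (1 - q₁) ^ 0 * q₂ ^ 2 * (1 - q₂) ^ 0 * epsQtI32 r s m :=
      mul_nonneg (w2 1 3 2 (by norm_num)) hepsQtI32
    linarith [key, e00, e01, e02, e10, e11, e12, e20, e21, e22, e30, e31, e32]
  rw [iQt4_factor]
  exact mul_nonneg hq₂1 hE

end MainQtI

end CaseOne

end Summit.Ventures.PercRepro2
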